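import Literature.MathematicalPhysics.QuantumFieldTheory.Balaban1983to89.Node00.OpsYLeibnizLetters
import Literature.MathematicalPhysics.QuantumFieldTheory.Balaban1983to89.Node00.OpsYSectDCoords
import Literature.MathematicalPhysics.QuantumFieldTheory.Balaban1983to89.B9CoReadingCoordsS

/-!
# `Balaban1983to89.B9WalkLettersCoordsLeib` — [B9] (3.88)∕(3.100) pp. 409∕413: THE LEIBNIZ LETTERS OF THE SITE-SECTOR WALK AS COORDINATE MODELS, and the three
# SIX clauses `leibD ∕ leibT ∕ leibL ∕ inv ∕ eq388 ∕ eq388T` of the rows-18 schema `Identities₂` AS THEOREMS on the coordinate carrier `XSK κ i`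
# (piece W-a, FILE C-2 part 1 of node00-def-Y's `W-a-DESIGN.md` §3; HOME `pub-ymgap-dag-n06-d/W-a-C2-PLAN.md`)

T. Bałaban, *Propagators for lattice gauge theories in a background field*, Commun. Math. Phys. **99** (1985) 389–434 [`Balaban1985BackgroundPropagators`, "B9"];
[4] = T. Bałaban, *Propagators and renormalization transformations for lattice gauge theories. II*, Commun. Math. Phys. **96** (1984) 223–250 [`Balaban1984PropagatorsII`].
statement-level skeleton of published theorems with citation tags; proofs where landed; nothing here is a claim about the Yang–Mills mass gap.

THE PRINT.  (3.88) p. 409: `Δ′_a(hλ) = h(Δ′_aλ) − K(h)λ`, `K(h) = Σ_b(∂h)(b)(D_Uλ)(b) + (Δh)λ + (averaging line)`; (3.100) p. 413: `D_μ(hA) = h D_μA + (∂_μh)R(U)A(·+e_μ)` and its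
backward twin; (3.8) p. 392 (∇*_U is the transpose of ∇_U).  node00-def-Y's FILE 37 (`Node00.OpsYLeibnizLetters`, p606xxx) proved these AS OPERATOR IDENTITIES at the 𝔸-level
letters (`cdSL_mul_cutMulY`, `cutMulY_mul_cdsSL_leib`, `lapSL_mul_cutMulY`, `KhY_eq_grad_right ∕ _div_left`, `eq388T_GsqY`, `GpY_eq_fixedPoint388T`) with the named letters
`pKY cKY ptKY ctKY cltY` (print's `P_□ ∕ C_□` split per lattice direction).

THE POINT (the N06 certificate, dag-n06-d; the rows-18 schema `B9Thm37WholeDir.Identities₂ (𝔬 x) (𝔡 x) (𝔩 x) 1 (H x) U` displayed inside `h36`).  The certificate reads its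
operators on the coordinate carrier `XSK κ i` through `B9CoReadingCoords.coordOpK b` with print's scalings (`B9CoReadingCoordsS.GcoS = (η²·c_R)•…`, `DcoS ∕ DscoS = η⁻¹•…`,
`LcoS = η⁻²•…`, the direction pins `𝔡.Dd U μ = η⁻¹ • coordOpK b (fun _ => cdSL U μ)`).  THIS FILE defines the matching coordinate models of the FILE-37 letters — the SCALINGS
being the ones that make the clauses of `Identities₂` literally true at the pinned `Gp ∕ Gsq ∕ D ∕ Dstar ∕ Lap ∕ Dd ∕ Dsd` — and proves the four U-ALGEBRAIC clauses:
* §1 (private) `rS`-bookkeeping (restriction of scalars of products∕sums) and `coordOpK` sums; §2 the models `mulcoS` (M_h), `dirDcoS ∕ dirDscoS` (∇_{U,μ}, ∇*_{U,μ}, `η⁻¹`),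
  `cdcoS` (C^D, `η⁻¹`, slice-wise), `cltcoS` (C^{Lt}, `η⁻¹`), `plcoS` (P^L_μ = `−η⁻¹`•P_μ), `clcoS` (C^L = `−η⁻²`•M_{Δh}), `pcoS` (P_μ, `(ηc_R)⁻¹`), `ccoS` (C, `(η²c_R)⁻¹`),
  `ptcoS ∕ ctcoS` (Pᵗ_μ, Cᵗ), `dacoS` (Δ′_a, `(η²c_R)⁻¹`);
* §3 ★★ `leibD_coords` (`DcoS ∘ M_h = M_h ∘ DcoS + (0 ∘ DcoS + C^D)` — the `Identities₂.leibD` clause with `PD := 0`), ★★ `leibT_coords` (`M_h ∘ DscoS = DscoS ∘ M_h + C^{Lt}`),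
  ★★ `leibL_coords` (`LcoS ∘ M_h = M_h ∘ LcoS + (Σ_μ P^L_μ * Dd_μ + C^L)`), ★ `inv_coords` (`GcoS(G′) * dacoS = 1` wherever `Δ′_a(U)` is a unit — Theorem 3.1's regime; the
  unit is a HYPOTHESIS here).
* §4 ★ `coordAlgHom` (the constant-family coordinate model IS an ℝ-algebra morphism `Module.End ℂ (SiteY i → 𝔸) →ₐ[ℝ] Module.End ℝ (XSK κ i → ℝ)`), `gsqDcoS` (the cube
  inverse `G′_□(U)` = node00-def-Y's `GsqY` on the carrier, scaling `η²c_R`), ★★ `eq388_coords` ∕ ★★ `eq388T_coords` — the two (3.88) clauses of `Identities₂`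
  (`Δ′_a·Σ_□ M_hG′_□M_h = 1 − Σ_□(Σ_μP_μ∇_μ + C)G′_□M_h` and its transpose) at the models over ANY real family with `Σh² = 1` supported in its cube domains, under the
  compressed-`Δ′_a` unit hypotheses (node00-def-Y `eq388_GsqY ∕ eq388T_GsqY` + `KhY_eq_grad_right ∕ KhY_eq_div_left`).
So SIX of `Identities₂`'s clauses (`leibD leibT leibL inv eq388 eq388T`) are theorems at the models; the kernel dominations `hP … hCLt` + `K*_nonneg ∕ _sum` (U-free kernels,
def-Y FILE 38 sizes), the record `opsWalkY` and `StaticOK` are FILE C-2 parts 2–3 (HOME `W-a-C2-PLAN.md`).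
HONEST SCOPE.  Definitions with bodies + operator algebra over landed identities; nothing of [B9]'s estimates asserted; COUNT-NEUTRAL; N06 NOT discharged; one finite 𝕋⁴ programme
at fixed `ε` — NOT continuum, NOT OS, NOT the mass gap ∕ Clay.  Cell `pub-ymgap` (HUMAN RULING D-0062), node N06 [B9], seat `pub-ymgap-dag-n06-d` (g13), 2026-08-28.  NEW file.
-/

noncomputable section

namespace Literature.MathematicalPhysics.QuantumFieldTheory.Balaban1983to89.B9WalkLettersCoordsLeib

open Node00
open Node00.OpsYLeibnizLetters (fdiffY bdiffY lapDiffY fshiftSL bshiftSL cltY pKY cKY ptKY ctKY cdSL_mul_cutMulY cutMulY_mul_cdsSL_leib lapSL_mul_cutMulY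
  KhY_eq_grad_right KhY_eq_div_left eq388T_GsqY)
open Node00.OpsYSectDCoords (coordOpK_add coordOpK_sub coordOpK_smul coordOpK_const_mul coordOpK_const_one)
open B6KLevelCensusIndexV1 (KIdx)
open B9Ineq349SiteComposite (cdSL cdsSL etaS_pos)
open B9Thm37CubeCoverCommutators (cutMulY KhY)
open B9Thm39ReadingCoords (cR39)
open B9CoReadingCoords (coordOpK coordOpK_comp)
open B9CoReadingCoordsS (XSK GcoS DcoS DscoS LcoS lapSₗ lapSₗ_apply)

variable {𝔸 : Type} [NormedRing 𝔸] [NormedAlgebra ℂ 𝔸] [CompleteSpace 𝔸]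
variable {κ : Type} [Fintype κ] [DecidableEq κ]
variable {d ℓ : ℕ} {hd : 1 ≤ d + 1} {hL : Odd (ℓ + 1) ∧ 1 < ℓ + 1} {b₀ b₁ : ℝ}
variable (i : KIdx d ℓ hd hL b₀ b₁) (b : Module.Basis κ ℝ 𝔸) (B : B9.Backgrounds) (cfg : B.Cfg → CfgY 𝔸 i) (parS : SiteParY 𝔸 i)

/-! ## §1 Bookkeeping: restriction of scalars and sums of coordinate models -/

section RS

variable {V : Type} [AddCommGroup V] [Module ℂ V]

omit [Fintype κ] [DecidableEq κ] in
/-- `(A * B)|_ℝ = A|_ℝ ∘ B|_ℝ`. [folklore] -/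
private theorem rS_mul (A C : Module.End ℂ V) : (A * C).restrictScalars ℝ = A.restrictScalars ℝ ∘ₗ C.restrictScalars ℝ := rfl

omit [Fintype κ] [DecidableEq κ] in
/-- `(A + B)|_ℝ = A|_ℝ + B|_ℝ`. [folklore] -/
private theorem rS_add (A C : Module.End ℂ V) : (A + C).restrictScalars ℝ = A.restrictScalars ℝ + C.restrictScalars ℝ := rfl

omit [Fintype κ] [DecidableEq κ] in
/-- `(A − B)|_ℝ = A|_ℝ − B|_ℝ`. [folklore] -/
private theorem rS_sub (A C : Module.End ℂ V) : (A - C).restrictScalars ℝ = A.restrictScalars ℝ - C.restrictScalars ℝ := rfl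

omit [Fintype κ] [DecidableEq κ] in
/-- `(−A)|_ℝ = −A|_ℝ`. [folklore] -/
private theorem rS_neg (A : Module.End ℂ V) : (-A).restrictScalars ℝ = -A.restrictScalars ℝ := rfl

omit [Fintype κ] [DecidableEq κ] in
/-- `1|_ℝ = 1`. [folklore] -/
private theorem rS_one : (1 : Module.End ℂ V).restrictScalars ℝ = (1 : Module.End ℝ V) := rfl

omit [Fintype κ] [DecidableEq κ] in
/-- `(Σ_μ A_μ)|_ℝ = Σ_μ A_μ|_ℝ`. [folklore] -/
private theorem rS_sum {P : Type} [Fintype P] (A : P → Module.End ℂ V) : (∑ μ, A μ).restrictScalars ℝ = ∑ μ, (A μ).restrictScalars ℝ :=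
  LinearMap.ext fun v => by rw [LinearMap.restrictScalars_apply, LinearMap.sum_apply, LinearMap.sum_apply]; rfl

end RS

section Sums

variable {S D : Type}

omit [DecidableEq κ] [CompleteSpace 𝔸] in
/-- the coordinate model of a finite sum of families is the sum of the models. [cite: Balaban1985BackgroundPropagators, (3.42) p.397, dictionary] -/
theorem coordOpK_sum {P : Type} [Fintype P] (T : P → D → (S → 𝔸) →ₗ[ℝ] (S → 𝔸)) :
    coordOpK b (fun ν => ∑ μ, T μ ν) = ∑ μ, coordOpK b (T μ) := by
  apply LinearMap.ext; intro f; funext p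
  simp only [B9CoReadingCoords.coordOpK_apply, LinearMap.sum_apply, Finset.sum_apply, map_sum, Finsupp.coe_finsetSum]

omit [DecidableEq κ] [CompleteSpace 𝔸] in
/-- the model of the zero family is zero. [cite: Balaban1985BackgroundPropagators, (3.42) p.397, dictionary] -/
theorem coordOpK_zero : coordOpK b (fun _ : D => (0 : (S → 𝔸) →ₗ[ℝ] (S → 𝔸))) = 0 := by
  apply LinearMap.ext; intro f; funext p
  simp only [B9CoReadingCoords.coordOpK_apply, LinearMap.zero_apply, Pi.zero_apply, map_zero, Finsupp.coe_zero]

omit [DecidableEq κ] [CompleteSpace 𝔸] in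
/-- negation in the family. [cite: Balaban1985BackgroundPropagators, (3.42) p.397, dictionary] -/
theorem coordOpK_neg (T : D → (S → 𝔸) →ₗ[ℝ] (S → 𝔸)) : coordOpK b (fun ν => -T ν) = -coordOpK b T := by
  apply LinearMap.ext; intro f; funext p
  simp only [B9CoReadingCoords.coordOpK_apply, LinearMap.neg_apply, Pi.neg_apply, map_neg, Finsupp.coe_neg]

omit [DecidableEq κ] [CompleteSpace 𝔸] in
/-- slice-wise composite of a slice family with a constant family. [cite: Balaban1985BackgroundPropagators, (3.42) p.397, dictionary] -/
theorem coordOpK_comp' (T T' : D → (S → 𝔸) →ₗ[ℝ] (S → 𝔸)) : coordOpK b (fun ν => T ν ∘ₗ T' ν) = coordOpK b T ∘ₗ coordOpK b T' :=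
  (coordOpK_comp b T T').symm

end Sums

/-! ## §2 The coordinate models of the Leibniz ∕ K-letters -/

variable [FiniteDimensional ℝ 𝔸]

/-- `M_h` on the carrier: the constant family of the real cut-off `cutMulY h` (= the certificate's `mulOp (h ∘ Prod.fst)`, dag-n06-w7 `mulOp_hWalkY_eq_coordOpK` at the trace
coordinates). [cite: Balaban1985BackgroundPropagators, (3.87) p.409 («h_□»)] -/
def mulcoS (h : SiteY i → ℝ) : (XSK κ i → ℝ) →ₗ[ℝ] (XSK κ i → ℝ) := coordOpK b (fun _ : Fin (d + 1) => (cutMulY (𝔸 := 𝔸) h).restrictScalars ℝ)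

/-- `∇_{U,μ}` on every slice (the certificate's `𝔡.Dd U μ`), prefactor `η⁻¹`. [cite: Balaban1985BackgroundPropagators, (3.8) p.392, (3.42) p.397] -/
def dirDcoS (U₁ : B.Cfg) (μ : Fin (d + 1)) : Module.End ℝ (XSK κ i → ℝ) := (etaS i)⁻¹ • coordOpK b (fun _ : Fin (d + 1) => (cdSL i (cfg U₁) μ).restrictScalars ℝ)

/-- `∇*_{U,μ}` on every slice (the certificate's `𝔡.Dsd U μ`), prefactor `η⁻¹`. [cite: Balaban1985BackgroundPropagators, (3.8) p.392, (3.42) p.397] -/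
def dirDscoS (U₁ : B.Cfg) (μ : Fin (d + 1)) : Module.End ℝ (XSK κ i → ℝ) := (etaS i)⁻¹ • coordOpK b (fun _ : Fin (d + 1) => (cdsSL i (cfg U₁) μ).restrictScalars ℝ)

/-- the `leibD` letter `C^D(U,h)`: on slice `ν`, `η⁻¹·M_{∂⁺_νh}∘S_ν` ((3.100) forward). [cite: Balaban1985BackgroundPropagators, (3.100) p.413] -/
def cdcoS (U₁ : B.Cfg) (h : SiteY i → ℝ) : Module.End ℝ (XSK κ i → ℝ) :=
  (etaS i)⁻¹ • coordOpK b (fun ν : Fin (d + 1) => (cutMulY (fdiffY i h ν) * fshiftSL i (cfg U₁) ν).restrictScalars ℝ)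

/-- the `leibT` letter `C^{Lt}(U,h)`: on slice `ν`, `η⁻¹·C^{Lt}_ν = −η⁻¹·M_{∂⁻̃_νh}∘S*_ν` ((3.100) backward). [cite: Balaban1985BackgroundPropagators, (3.100) p.413, (3.8) p.392] -/
def cltcoS (U₁ : B.Cfg) (h : SiteY i → ℝ) : Module.End ℝ (XSK κ i → ℝ) :=
  (etaS i)⁻¹ • coordOpK b (fun ν : Fin (d + 1) => (cltY i (cfg U₁) h ν).restrictScalars ℝ)

/-- the `leibL` letter `P^L_μ(U,h) := −η⁻¹·P_μ(U,h)` (to be composed with `Dd_μ = η⁻¹∇_μ`: total `η⁻²`, the Laplacian's scaling). [cite: Balaban1985BackgroundPropagators, (3.88) p.409, (3.100) p.413] -/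
def plcoS (U₁ : B.Cfg) (h : SiteY i → ℝ) (μ : Fin (d + 1)) : Module.End ℝ (XSK κ i → ℝ) :=
  -((etaS i)⁻¹ • coordOpK b (fun _ : Fin (d + 1) => (pKY i (cfg U₁) h μ).restrictScalars ℝ))

/-- the `leibL` letter `C^L(h) := −η⁻²·M_{Δh}`. [cite: Balaban1985BackgroundPropagators, (3.88) p.409, (3.100) p.413] -/
def clcoS (h : SiteY i → ℝ) : Module.End ℝ (XSK κ i → ℝ) :=
  -((etaS i ^ 2)⁻¹ • coordOpK b (fun _ : Fin (d + 1) => (cutMulY (𝔸 := 𝔸) (lapDiffY i h)).restrictScalars ℝ))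

/-- print's `P_□`-letter per direction on the carrier, scaling `(η·c_R)⁻¹` (so that `P_μ * Dd_μ` carries `(η²c_R)⁻¹`, the inverse of `GcoS`'s prefactor).
[cite: Balaban1985BackgroundPropagators, (3.88)–(3.89) p.409; Balaban1984PropagatorsII, (2.39)–(2.40) pp.229–230] -/
def pcoS (U₁ : B.Cfg) (h : SiteY i → ℝ) (μ : Fin (d + 1)) : Module.End ℝ (XSK κ i → ℝ) :=
  (etaS i * cR39 b)⁻¹ • coordOpK b (fun _ : Fin (d + 1) => (pKY i (cfg U₁) h μ).restrictScalars ℝ)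

/-- print's `C_□`-letter on the carrier, scaling `(η²·c_R)⁻¹`. [cite: Balaban1985BackgroundPropagators, (3.88)–(3.89) p.409; Balaban1984PropagatorsII, (2.39)–(2.40) pp.229–230] -/
def ccoS (U₁ : B.Cfg) (h : SiteY i → ℝ) : Module.End ℝ (XSK κ i → ℝ) :=
  (etaS i ^ 2 * cR39 b)⁻¹ • coordOpK b (fun _ : Fin (d + 1) => (cKY i parS h (cfg U₁)).restrictScalars ℝ)

/-- the transposed `Pᵗ_□`-letter per direction, scaling `(η·c_R)⁻¹`. [cite: Balaban1985BackgroundPropagators, (3.88)–(3.89) p.409] -/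
def ptcoS (U₁ : B.Cfg) (h : SiteY i → ℝ) (μ : Fin (d + 1)) : Module.End ℝ (XSK κ i → ℝ) :=
  (etaS i * cR39 b)⁻¹ • coordOpK b (fun _ : Fin (d + 1) => (ptKY i (cfg U₁) h μ).restrictScalars ℝ)

/-- the transposed `Cᵗ_□`-letter, scaling `(η²·c_R)⁻¹`. [cite: Balaban1985BackgroundPropagators, (3.88)–(3.89) p.409] -/
def ctcoS (U₁ : B.Cfg) (h : SiteY i → ℝ) : Module.End ℝ (XSK κ i → ℝ) :=
  (etaS i ^ 2 * cR39 b)⁻¹ • coordOpK b (fun _ : Fin (d + 1) => (ctKY i parS h (cfg U₁)).restrictScalars ℝ)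

/-- `Δ′_a(U)` on the carrier, scaling `(η²·c_R)⁻¹` = the inverse of `GcoS`'s. [cite: Balaban1985BackgroundPropagators, (3.24)–(3.25) p.394] -/
def dacoS (U₁ : B.Cfg) : Module.End ℝ (XSK κ i → ℝ) :=
  (etaS i ^ 2 * cR39 b)⁻¹ • coordOpK b (fun _ : Fin (d + 1) => (deltaPrimeAY i parS (cfg U₁)).restrictScalars ℝ)

/-! ## §3 The Leibniz clauses and the inverse clause of `Identities₂` at the models -/

omit [DecidableEq κ] [FiniteDimensional ℝ 𝔸] in
/-- `Δ_U` on the carrier (`LcoS`) IS the constant family of def-Y's ℂ-linear `lapSL`, scaled `η⁻²`. [cite: Balaban1985BackgroundPropagators, (3.23) p.394, bookkeeping] -/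
theorem LcoS_eq (U₁ : B.Cfg) : LcoS i b B cfg U₁ = (etaS i ^ 2)⁻¹ • coordOpK b (fun _ : Fin (d + 1) => (lapSL i (cfg U₁)).restrictScalars ℝ) := by
  have h : lapSₗ i (cfg U₁) = (lapSL (𝔸 := 𝔸) i (cfg U₁)).restrictScalars ℝ := LinearMap.ext fun Φ => by rw [lapSₗ_apply]; rfl
  rw [LcoS, h]

omit [DecidableEq κ] [FiniteDimensional ℝ 𝔸] in
/-- ★★ **`Identities₂.leibD` AT THE MODELS** ((3.100) forward through the coordinates): `∇_U∘M_h = M_h∘∇_U + (0∘∇_U + C^D(U,h))` on the carrier (`PD := 0`).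
[cite: Balaban1985BackgroundPropagators, (3.100) p.413, (3.42) p.397] -/
theorem leibD_coords (U₁ : B.Cfg) (h : SiteY i → ℝ) :
    DcoS i b B cfg U₁ ∘ₗ mulcoS i b h = mulcoS i b h ∘ₗ DcoS i b B cfg U₁ + ((0 : Module.End ℝ (XSK κ i → ℝ)) ∘ₗ DcoS i b B cfg U₁ + cdcoS i b B cfg U₁ h) := by
  have hν : (fun ν : Fin (d + 1) => (cdSL i (cfg U₁) ν).restrictScalars ℝ ∘ₗ (cutMulY (𝔸 := 𝔸) h).restrictScalars ℝ) =
      fun ν => (cutMulY (𝔸 := 𝔸) h).restrictScalars ℝ ∘ₗ (cdSL i (cfg U₁) ν).restrictScalars ℝ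
        + (cutMulY (fdiffY i h ν) * fshiftSL i (cfg U₁) ν).restrictScalars ℝ := by
    funext ν; rw [← rS_mul, cdSL_mul_cutMulY, rS_add, rS_mul]
  rw [DcoS, mulcoS, cdcoS, LinearMap.zero_comp, zero_add, LinearMap.smul_comp, LinearMap.comp_smul, coordOpK_comp, coordOpK_comp, hν,
    coordOpK_add, smul_add]

omit [DecidableEq κ] [FiniteDimensional ℝ 𝔸] in
/-- ★★ **`Identities₂.leibT` AT THE MODELS** ((3.100) backward): `M_h∘∇*_U = ∇*_U∘M_h + C^{Lt}(U,h)`. [cite: Balaban1985BackgroundPropagators, (3.100) p.413, (3.8) p.392] -/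
theorem leibT_coords (U₁ : B.Cfg) (h : SiteY i → ℝ) :
    mulcoS i b h ∘ₗ DscoS i b B cfg U₁ = DscoS i b B cfg U₁ ∘ₗ mulcoS i b h + cltcoS i b B cfg U₁ h := by
  have hν : (fun ν : Fin (d + 1) => (cutMulY (𝔸 := 𝔸) h).restrictScalars ℝ ∘ₗ (cdsSL i (cfg U₁) ν).restrictScalars ℝ) =
      fun ν => (cdsSL i (cfg U₁) ν).restrictScalars ℝ ∘ₗ (cutMulY (𝔸 := 𝔸) h).restrictScalars ℝ + (cltY i (cfg U₁) h ν).restrictScalars ℝ := by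
    funext ν; rw [← rS_mul, cutMulY_mul_cdsSL_leib, rS_add, rS_mul]
  rw [DscoS, mulcoS, cltcoS, LinearMap.smul_comp, LinearMap.comp_smul, coordOpK_comp, coordOpK_comp, hν, coordOpK_add, smul_add]

omit [DecidableEq κ] [FiniteDimensional ℝ 𝔸] in
/-- ★★ **`Identities₂.leibL` AT THE MODELS** (the first line of (3.88) with the `P`-letters composed with `∇_U` on the right): `Δ_U∘M_h = M_h∘Δ_U + (Σ_μ P^L_μ∘∇_{U,μ} + C^L)`
on the carrier, `Δ_U = LcoS` (`η⁻²`), `∇_{U,μ} = dirDcoS` (`η⁻¹`), `P^L_μ = −η⁻¹P_μ`, `C^L = −η⁻²M_{Δh}`. [cite: Balaban1985BackgroundPropagators, (3.88) p.409, (3.100) p.413] -/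
theorem leibL_coords (U₁ : B.Cfg) (h : SiteY i → ℝ) :
    LcoS i b B cfg U₁ ∘ₗ mulcoS i b h =
      mulcoS i b h ∘ₗ LcoS i b B cfg U₁ + ((∑ μ, plcoS i b B cfg U₁ h μ * dirDcoS i b B cfg U₁ μ) + clcoS i b h) := by
  -- the 𝔸-level identity, restricted to ℝ
  have hA : (lapSL i (cfg U₁)).restrictScalars ℝ ∘ₗ (cutMulY (𝔸 := 𝔸) h).restrictScalars ℝ =
      (cutMulY (𝔸 := 𝔸) h).restrictScalars ℝ ∘ₗ (lapSL i (cfg U₁)).restrictScalars ℝ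
        - ((∑ μ, (pKY i (cfg U₁) h μ).restrictScalars ℝ ∘ₗ (cdSL i (cfg U₁) μ).restrictScalars ℝ) + (cutMulY (𝔸 := 𝔸) (lapDiffY i h)).restrictScalars ℝ) := by
    rw [← rS_mul, lapSL_mul_cutMulY, rS_sub, rS_mul, rS_add, rS_sum]
    simp only [rS_mul]
  -- the slice terms `P^L_μ * Dd_μ` are constant families
  have hP : ∀ μ, plcoS i b B cfg U₁ h μ * dirDcoS i b B cfg U₁ μ =
      -((etaS i ^ 2)⁻¹ • coordOpK b (fun _ : Fin (d + 1) => (pKY i (cfg U₁) h μ).restrictScalars ℝ ∘ₗ (cdSL i (cfg U₁) μ).restrictScalars ℝ)) := by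
    intro μ
    rw [plcoS, dirDcoS, Module.End.mul_eq_comp, LinearMap.comp_smul, LinearMap.neg_comp, LinearMap.smul_comp, coordOpK_comp, smul_neg, smul_smul, ← mul_inv,
      ← pow_two]
  rw [LcoS_eq, mulcoS, clcoS, LinearMap.smul_comp, LinearMap.comp_smul, coordOpK_comp, coordOpK_comp, hA, coordOpK_sub, coordOpK_add, coordOpK_sum]
  simp only [hP, smul_add, smul_neg, Finset.smul_sum, sub_eq_add_neg, neg_add, ← Finset.sum_neg_distrib]

omit [DecidableEq κ] in
/-- ★ **`Identities₂.inv` AT THE MODELS**: `G′(U) * Δ′_a(U) = 1` on the carrier (`GcoS` at def-Y's `GpY`, times `dacoS`), wherever `Δ′_a(U)` is a unit (Theorem 3.1's regime —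
a HYPOTHESIS here). [cite: Balaban1985BackgroundPropagators, (3.24)–(3.25) p.394, Thm 3.1 p.397] -/
theorem inv_coords (hc : cR39 b ≠ 0) (U₁ : B.Cfg) (hU : IsUnit (deltaPrimeAY i parS (cfg U₁))) :
    GcoS i b B cfg (GpY i parS) U₁ * dacoS i b B cfg parS U₁ = 1 := by
  have hη : etaS i ^ 2 * cR39 b ≠ 0 := mul_ne_zero (pow_ne_zero 2 (etaS_pos i).ne') hc
  rw [GcoS, dacoS, Module.End.mul_eq_comp, LinearMap.smul_comp, LinearMap.comp_smul, coordOpK_comp, smul_smul, mul_inv_cancel₀ hη, one_smul]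
  have h1 : (fun _ : Fin (d + 1) => ((GpY i parS) (cfg U₁)).restrictScalars ℝ ∘ₗ (deltaPrimeAY i parS (cfg U₁)).restrictScalars ℝ) =
      fun _ : Fin (d + 1) => (1 : Module.End ℝ (SiteY i → 𝔸)) := by
    funext ν; rw [← rS_mul, GpY_mul_deltaPrimeAY i parS (cfg U₁) hU, rS_one]
  rw [h1, coordOpK_const_one]

/-! ## §4 The coordinate functor as an ℝ-algebra morphism; the (3.88) clauses `eq388 ∕ eq388T` at the models -/

omit [DecidableEq κ] [FiniteDimensional ℝ 𝔸] in
/-- `0|_ℝ = 0`. [folklore] -/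
private theorem rS_zero {V : Type} [AddCommGroup V] [Module ℂ V] : (0 : Module.End ℂ V).restrictScalars ℝ = (0 : Module.End ℝ V) := rfl

/-- ★ **THE CONSTANT-FAMILY COORDINATE MODEL IS AN ℝ-ALGEBRA MORPHISM** `Module.End ℂ (SiteY i → 𝔸) →ₐ[ℝ] Module.End ℝ (XSK κ i → ℝ)` (functoriality of
`coordOpK`: products, sums, units, real scalars). [cite: Balaban1985BackgroundPropagators, (3.42) p.397, dictionary] -/
def coordAlgHom : Module.End ℂ (SiteY i → 𝔸) →ₐ[ℝ] Module.End ℝ (XSK κ i → ℝ) where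
  toFun A := coordOpK b (fun _ : Fin (d + 1) => A.restrictScalars ℝ)
  map_one' := by simp only [rS_one, coordOpK_const_one]
  map_mul' A C := by simp only [rS_mul, ← Module.End.mul_eq_comp, coordOpK_const_mul]
  map_zero' := by simp only [rS_zero, coordOpK_zero]
  map_add' A C := by simp only [rS_add, coordOpK_add]
  commutes' r := by
    rw [Algebra.algebraMap_eq_smul_one, Algebra.algebraMap_eq_smul_one]
    have h : ((r • (1 : Module.End ℂ (SiteY i → 𝔸))).restrictScalars ℝ) = r • (1 : Module.End ℝ (SiteY i → 𝔸)) := rfl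
    simp only [h, coordOpK_smul, coordOpK_const_one]

omit [DecidableEq κ] [CompleteSpace 𝔸] [FiniteDimensional ℝ 𝔸] in
/-- `coordAlgHom`, unfolded. [cite: Balaban1985BackgroundPropagators, (3.42) p.397, dictionary] -/
theorem coordAlgHom_apply (A : Module.End ℂ (SiteY i → 𝔸)) : coordAlgHom i b A = coordOpK b (fun _ : Fin (d + 1) => A.restrictScalars ℝ) := rfl

/-- the cube local inverse `G′_□(U)` on the carrier over a cube domain `D` (the certificate's `Gsq U □` = `B9WalkLettersCoordsS.gsqcoS` at `D := cubeDomY x □`), scaling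
`η²·c_R` as `GcoS`. [cite: Balaban1985BackgroundPropagators, (3.79) p.406, (3.87) p.409] -/
def gsqDcoS (U₁ : B.Cfg) (D : Finset (SiteY i)) : Module.End ℝ (XSK κ i → ℝ) :=
  (etaS i ^ 2 * cR39 b) • coordOpK b (fun _ : Fin (d + 1) => (OpsYLocalInverse.GsqY i parS D (cfg U₁)).restrictScalars ℝ)

omit [DecidableEq κ] in
/-- ★★ **`Identities₂.eq388` AT THE MODELS** ((3.88) «Δ′_aG′₀ = I − Σ_□K(h_□)G′_□h_□» with `K(h) = Σ_μ P_μ∇_{U,μ} + C`): over any real family `h_c` with `Σ_c h_c² = 1`, each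
supported in its cube domain `D c` with the compressed `Δ′_a(U)` invertible there (HYPOTHESES — Theorem 3.1's regime),
`Δ′_a * Σ_c M_{h_c} G′_{□_c} M_{h_c} = 1 − Σ_c ((Σ_μ P_{c,μ} * ∇_{U,μ}) + C_c) * G′_{□_c} * M_{h_c}` on the carrier. [cite: Balaban1985BackgroundPropagators, (3.87)–(3.90) p.409] -/
theorem eq388_coords (hc : cR39 b ≠ 0) (U₁ : B.Cfg) {ι : Type} [Fintype ι] (hf : ι → SiteY i → ℝ) (hsq : ∀ z, ∑ c, hf c z ^ 2 = 1)
    (D : ι → Finset (SiteY i)) (hD : ∀ c z, hf c z ≠ 0 → z ∈ D c) (hU : ∀ c, IsUnit (OpsYLocalInverse.padDeltaY i parS (D c) (cfg U₁))) :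
    dacoS i b B cfg parS U₁ * (∑ c, mulcoS i b (hf c) * gsqDcoS i b B cfg parS U₁ (D c) * mulcoS i b (hf c))
      = 1 - ∑ c, ((∑ μ, pcoS i b B cfg U₁ (hf c) μ * dirDcoS i b B cfg U₁ μ) + ccoS i b B cfg parS U₁ (hf c))
          * gsqDcoS i b B cfg parS U₁ (D c) * mulcoS i b (hf c) := by
  set s : ℝ := etaS i ^ 2 * cR39 b with hs
  have hs0 : s ≠ 0 := mul_ne_zero (pow_ne_zero 2 (etaS_pos i).ne') hc
  have hη : etaS i ≠ 0 := (etaS_pos i).ne'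
  -- everything is `scalar • φ(letter)` for the algebra morphism φ
  have eM : ∀ c, mulcoS i b (hf c) = coordAlgHom i b (cutMulY (hf c)) := fun c => rfl
  have eG : ∀ c, gsqDcoS i b B cfg parS U₁ (D c) = s • coordAlgHom i b (OpsYLocalInverse.GsqY i parS (D c) (cfg U₁)) := fun c => rfl
  have eΔ : dacoS i b B cfg parS U₁ = s⁻¹ • coordAlgHom i b (deltaPrimeAY i parS (cfg U₁)) := rfl
  have eP : ∀ c μ, pcoS i b B cfg U₁ (hf c) μ * dirDcoS i b B cfg U₁ μ = s⁻¹ • coordAlgHom i b (pKY i (cfg U₁) (hf c) μ * cdSL i (cfg U₁) μ) := by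
    intro c μ
    have e1 : pcoS i b B cfg U₁ (hf c) μ = (etaS i * cR39 b)⁻¹ • coordAlgHom i b (pKY i (cfg U₁) (hf c) μ) := rfl
    have e2 : dirDcoS i b B cfg U₁ μ = (etaS i)⁻¹ • coordAlgHom i b (cdSL i (cfg U₁) μ) := rfl
    rw [e1, e2, smul_mul_smul_comm, ← map_mul]
    congr 1
    rw [hs]; field_simp
  have eC : ∀ c, ccoS i b B cfg parS U₁ (hf c) = s⁻¹ • coordAlgHom i b (cKY i parS (hf c) (cfg U₁)) := fun c => rfl
  have eK : ∀ c, (∑ μ, pcoS i b B cfg U₁ (hf c) μ * dirDcoS i b B cfg U₁ μ) + ccoS i b B cfg parS U₁ (hf c)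
      = s⁻¹ • coordAlgHom i b (KhY i parS (hf c) (cfg U₁)) := by
    intro c
    simp only [eP, eC, ← Finset.smul_sum, ← smul_add, ← map_sum, ← map_add, ← KhY_eq_grad_right]
  simp only [eM, eG, eΔ, eK]
  -- scalar bookkeeping: s⁻¹ and s cancel termwise
  have lhs : ∀ c, coordAlgHom i b (cutMulY (hf c)) * (s • coordAlgHom i b (OpsYLocalInverse.GsqY i parS (D c) (cfg U₁))) * coordAlgHom i b (cutMulY (hf c))
      = s • coordAlgHom i b (cutMulY (hf c) * OpsYLocalInverse.GsqY i parS (D c) (cfg U₁) * cutMulY (hf c)) := by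
    intro c; rw [mul_smul_comm, smul_mul_assoc, map_mul, map_mul]
  simp only [lhs, ← Finset.smul_sum, ← map_sum, smul_mul_smul_comm, inv_mul_cancel₀ hs0, one_smul, ← map_mul,
    OpsYLocalInverse.eq388_GsqY i parS (cfg U₁) hf hsq D hD hU, map_sub, map_one]

omit [DecidableEq κ] in
/-- ★★ **`Identities₂.eq388T` AT THE MODELS** ((3.88) transposed «G′₀Δ′_a = I − Σ_□ h_□G′_□(∇*_UPᵗ_□ + Cᵗ_□)»): same hypotheses,
`(Σ_c M_{h_c} G′_{□_c} M_{h_c}) * Δ′_a = 1 − Σ_c M_{h_c} G′_{□_c} ((Σ_μ ∇*_{U,μ} * Pᵗ_{c,μ}) + Cᵗ_c)` on the carrier. [cite: Balaban1985BackgroundPropagators, (3.87)–(3.90) p.409, (3.8) p.392] -/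
theorem eq388T_coords (hc : cR39 b ≠ 0) (U₁ : B.Cfg) {ι : Type} [Fintype ι] (hf : ι → SiteY i → ℝ) (hsq : ∀ z, ∑ c, hf c z ^ 2 = 1)
    (D : ι → Finset (SiteY i)) (hD : ∀ c z, hf c z ≠ 0 → z ∈ D c) (hU : ∀ c, IsUnit (OpsYLocalInverse.padDeltaY i parS (D c) (cfg U₁))) :
    (∑ c, mulcoS i b (hf c) * gsqDcoS i b B cfg parS U₁ (D c) * mulcoS i b (hf c)) * dacoS i b B cfg parS U₁
      = 1 - ∑ c, mulcoS i b (hf c) * gsqDcoS i b B cfg parS U₁ (D c)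
          * ((∑ μ, dirDscoS i b B cfg U₁ μ * ptcoS i b B cfg U₁ (hf c) μ) + ctcoS i b B cfg parS U₁ (hf c)) := by
  set s : ℝ := etaS i ^ 2 * cR39 b with hs
  have hs0 : s ≠ 0 := mul_ne_zero (pow_ne_zero 2 (etaS_pos i).ne') hc
  have hη : etaS i ≠ 0 := (etaS_pos i).ne'
  have eM : ∀ c, mulcoS i b (hf c) = coordAlgHom i b (cutMulY (hf c)) := fun c => rfl
  have eG : ∀ c, gsqDcoS i b B cfg parS U₁ (D c) = s • coordAlgHom i b (OpsYLocalInverse.GsqY i parS (D c) (cfg U₁)) := fun c => rfl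
  have eΔ : dacoS i b B cfg parS U₁ = s⁻¹ • coordAlgHom i b (deltaPrimeAY i parS (cfg U₁)) := rfl
  have eP : ∀ c μ, dirDscoS i b B cfg U₁ μ * ptcoS i b B cfg U₁ (hf c) μ = s⁻¹ • coordAlgHom i b (cdsSL i (cfg U₁) μ * ptKY i (cfg U₁) (hf c) μ) := by
    intro c μ
    have e1 : ptcoS i b B cfg U₁ (hf c) μ = (etaS i * cR39 b)⁻¹ • coordAlgHom i b (ptKY i (cfg U₁) (hf c) μ) := rfl
    have e2 : dirDscoS i b B cfg U₁ μ = (etaS i)⁻¹ • coordAlgHom i b (cdsSL i (cfg U₁) μ) := rfl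
    rw [e1, e2, smul_mul_smul_comm, ← map_mul]
    congr 1
    rw [hs]; field_simp
  have eC : ∀ c, ctcoS i b B cfg parS U₁ (hf c) = s⁻¹ • coordAlgHom i b (ctKY i parS (hf c) (cfg U₁)) := fun c => rfl
  have eK : ∀ c, (∑ μ, dirDscoS i b B cfg U₁ μ * ptcoS i b B cfg U₁ (hf c) μ) + ctcoS i b B cfg parS U₁ (hf c)
      = s⁻¹ • coordAlgHom i b ((∑ μ, cdsSL i (cfg U₁) μ * ptKY i (cfg U₁) (hf c) μ) + ctKY i parS (hf c) (cfg U₁)) := by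
    intro c
    simp only [eP, eC, ← Finset.smul_sum, ← smul_add, ← map_sum, ← map_add]
  simp only [eM, eG, eΔ, eK]
  have lhs : ∀ c, coordAlgHom i b (cutMulY (hf c)) * (s • coordAlgHom i b (OpsYLocalInverse.GsqY i parS (D c) (cfg U₁))) * coordAlgHom i b (cutMulY (hf c))
      = s • coordAlgHom i b (cutMulY (hf c) * OpsYLocalInverse.GsqY i parS (D c) (cfg U₁) * cutMulY (hf c)) := by
    intro c; rw [mul_smul_comm, smul_mul_assoc, map_mul, map_mul]
  have rhs : ∀ c, coordAlgHom i b (cutMulY (hf c)) * (s • coordAlgHom i b (OpsYLocalInverse.GsqY i parS (D c) (cfg U₁)))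
      * (s⁻¹ • coordAlgHom i b ((∑ μ, cdsSL i (cfg U₁) μ * ptKY i (cfg U₁) (hf c) μ) + ctKY i parS (hf c) (cfg U₁)))
      = coordAlgHom i b (cutMulY (hf c) * OpsYLocalInverse.GsqY i parS (D c) (cfg U₁)
          * ((∑ μ, cdsSL i (cfg U₁) μ * ptKY i (cfg U₁) (hf c) μ) + ctKY i parS (hf c) (cfg U₁))) := by
    intro c; simp only [mul_smul_comm, smul_mul_assoc, smul_smul, inv_mul_cancel₀ hs0, one_smul, map_mul]
  -- at the 𝔸-level: `h G K(h) = −(h G (Σ∇*Pᵗ + Cᵗ))` (def-Y `KhY_eq_div_left`)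
  have hK : ∀ c, cutMulY (hf c) * OpsYLocalInverse.GsqY i parS (D c) (cfg U₁) * KhY i parS (hf c) (cfg U₁)
      = -(cutMulY (hf c) * OpsYLocalInverse.GsqY i parS (D c) (cfg U₁) * ((∑ μ, cdsSL i (cfg U₁) μ * ptKY i (cfg U₁) (hf c) μ) + ctKY i parS (hf c) (cfg U₁))) := by
    intro c; rw [KhY_eq_div_left]
    exact mul_neg (cutMulY (hf c) * OpsYLocalInverse.GsqY i parS (D c) (cfg U₁) : Module.End ℂ (SiteY i → 𝔸)) _
  simp only [lhs, rhs, ← Finset.smul_sum, ← map_sum, smul_mul_smul_comm, mul_inv_cancel₀ hs0, one_smul, ← map_mul,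
    eq388T_GsqY i parS (cfg U₁) hf hsq D hD hU, hK, Finset.sum_neg_distrib, ← sub_eq_add_neg, map_sub, map_one]

end Literature.MathematicalPhysics.QuantumFieldTheory.Balaban1983to89.B9WalkLettersCoordsLeib

end
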